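import Summits.BirchSwinnertonDyer.BirchSwinnertonDyer.Theses.GenusKolyvaginAtTwo
import Literature.NumberTheory.EllipticCurves.HeegnerPoints
import HarnessLib

/-!
# Route `GenusKolyvaginAtTwo`, LINES 18 / 19 (L_T `PowDvdShaCardAtTwoRT` stmt-BirchSwinnertonDyer-23242, L⁺_T `PowDvdShaCardAtTwoPosT`
# stmt-23379), skeleton v4.2 (pen `bsd-idea-1` g11): the displayed bundle of PUBLISHED INPUTS `PubInputsAtTwo` (definition; reviewed)

Seat `bsd-line-gk2-p3` g17 (cell `bsd-f1-sign2`), `--supports stmt-BirchSwinnertonDyer-23242`; kind definition.  One `def … : Prop`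
with body, no instance, no notation, no named fact, no `sorry`; BSD is not proved by any of this.

The LINE 18/19 skeletons v4.2 (`Cruxes/PowDvdShaCardAtTwoRT/…/plus_descent.lean`, `Cruxes/PowDvdShaCardAtTwoPosT/…/regular_plus_descent.lean`,
registered 2026-08-28T23:41Z) state three of their four stubs behind ONE antecedent `PubInputsAtTwo`: the conjunction — in the
antecedent order of the five-fact closer `GenusExactDescent.exactDescentAtTwo_ofFacts` — of the route's four displayed support items
`GrossZagierAllLevels` (stmt-24148), `MultPublishedInputsAtTwo` (stmt-19921), `EntireLFunctionRat` (stmt-19273), `MilneAnyModel`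
(stmt-24149) and, as second conjunct, Kolyvagin 1990 Thm. A at every level (`∀ N W K, Literature.NumberTheory.EllipticCurves.kolyvagin N W K`,
the tree's named Literature fact).  A skeleton lives under `Cruxes/` and cannot be imported by a `Theorems/` file, so a prover who
lands a stub BY NAME AND SIGNATURE needs the antecedent's name in the `Theorems` namespace: this file declares it, with the skeleton's
body VERBATIM (so `stub_… : PubInputsAtTwo → …` in `Theorems/…Stub.lean` has literally the registered signature).  It asserts
nothing: `PubInputsAtTwo` is a `Prop`, carried as a hypothesis and never counted as progress (pen's card `## v4.2`, stub P
`stub_pubInputsAtTwo` = the route's displayed conditional).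

References: [GrossZagier1986]; [Kolyvagin1989]; [BCDTJAMS2001]; [Milne1972ArithmeticAV] §1 Thm. 1; pen card
`Cruxes/PowDvdShaCardAtTwoRT/Lines/plus_descent.md` `## v4.2`.
-/

set_option autoImplicit false
-- the Theorems namespace of this sub repeats the summit name by design (D-0017 nested layout)
set_option linter.dupNamespace false

noncomputable section

namespace Summit.BirchSwinnertonDyer.BirchSwinnertonDyer.Theorems.GenusExact.PlusDescent

open Summit.BirchSwinnertonDyer.BirchSwinnertonDyer.Theses.GenusKolyvaginAtTwo

/-- **The published inputs of LINES 18/19, bundled** (skeleton v4.2 `PubInputsAtTwo`, body verbatim): Gross–Zagier at every level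
(`GrossZagierAllLevels`, route item stmt-BirchSwinnertonDyer-24148) ∧ Kolyvagin 1990 Thm. A at every level and Heegner field
(`∀ N W K, kolyvagin N W K`, the tree's named fact `Literature.NumberTheory.EllipticCurves.kolyvagin`) ∧ Gross–Zagier–Kolyvagin
`rank = r_an ∧ Ш finite` for `r_an ≤ 1` (`MultPublishedInputsAtTwo`, stmt-19921) ∧ modularity (`EntireLFunctionRat`, stmt-19273) ∧
Milne 1972 Thm. 1 for any model (`MilneAnyModel`, stmt-24149).  A hypothesis bundle posited by the LINE (pen card `## v4.2`), not a
claim and not a literature statement (its conjuncts are the route's own support items); references: Gross–Zagier 1986 Thm. I.6.3,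
Kolyvagin 1989 Thm. A, BCDT 2001 Thm. A, Milne 1972 §1 Thm. 1. -/
def PubInputsAtTwo : Prop :=
  GrossZagierAllLevels ∧
    (∀ (N : ℕ) [NeZero N] (W : WeierstrassCurve ℚ) (K : Type) [Field K] [NumberField K],
      Literature.NumberTheory.EllipticCurves.kolyvagin N W K) ∧
    MultPublishedInputsAtTwo ∧ EntireLFunctionRat ∧ MilneAnyModel

/-- Unfolding `PubInputsAtTwo` (definitional; pen card `## v4.2`). -/
theorem pubInputsAtTwo_iff :
    PubInputsAtTwo ↔ GrossZagierAllLevels ∧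
      (∀ (N : ℕ) [NeZero N] (W : WeierstrassCurve ℚ) (K : Type) [Field K] [NumberField K],
        Literature.NumberTheory.EllipticCurves.kolyvagin N W K) ∧
      MultPublishedInputsAtTwo ∧ EntireLFunctionRat ∧ MilneAnyModel :=
  Iff.rfl

/-- The Kolyvagin conjunct of `PubInputsAtTwo` (the `hKo` of `stub_milneDefect_of_facts`; Kolyvagin 1989 Thm. A as the tree's named fact
`Literature.NumberTheory.EllipticCurves.kolyvagin`). -/
theorem PubInputsAtTwo.kolyvagin (h : PubInputsAtTwo) :
    ∀ (N : ℕ) [NeZero N] (W : WeierstrassCurve ℚ) (K : Type) [Field K] [NumberField K],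
      Literature.NumberTheory.EllipticCurves.kolyvagin N W K :=
  h.2.1

/-- The Milne conjunct of `PubInputsAtTwo` (the `hMilne` of `stub_milneDefect_of_facts`: `MilneAnyModel` IS the named fact
`Milne1972.bsdQuotient_baseChange_quadratic_anyModel`, Milne 1972 §1 Thm. 1). -/
theorem PubInputsAtTwo.milne (h : PubInputsAtTwo) : MilneAnyModel :=
  h.2.2.2.2

end Summit.BirchSwinnertonDyer.BirchSwinnertonDyer.Theorems.GenusExact.PlusDescent

end
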